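import Literature.AlgebraicGeometry.Resolution.SliceCartierDivisor
import Literature.AlgebraicGeometry.Resolution.ExceptionalDivisorLocallyTrivial
import Literature.AlgebraicGeometry.Resolution.ExceptionalDivisorSmoothProjective
import Literature.AlgebraicGeometry.Resolution.ZariskiProjectiveBundle
import Literature.AlgebraicGeometry.Resolution.BlowupSmoothProjective
import Literature.AlgebraicGeometry.Resolution.GenericPointsOfClosure
import Literature.AlgebraicGeometry.Motives.ProjectiveSpaceFieldPoints
import Literature.AlgebraicGeometry.Motives.AlgebraicEquivalencePushforwardFacts
import Literature.AlgebraicGeometry.Motives.AbelianVarietyQuotientPoints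
import Literature.AlgebraicGeometry.Motives.BettiCycleClassProofs
import Literature.AlgebraicGeometry.HodgeTheory.HolomorphicBundleChernCharacterProjectiveSpace
import Literature.AlgebraicGeometry.HodgeTheory.GysinFormalismCorrespondences
import Literature.AlgebraicGeometry.HodgeTheory.IsoTransport
import Literature.AlgebraicGeometry.HodgeTheory.CorrespondenceSupportedVanishing
import Literature.AlgebraicGeometry.HodgeTheory.AlgebraicClassesPullback
import HarnessLib

/-!
# Deformation to the normal cone on the coniveau carrier, II: the CONSTANT-LIFT DEFORMATION DATUM,
# constructed (`M = Bl_{X × {t₁}}(Y × ℙ¹)`, Fulton 1998 §5.1), with the codimension bookkeeping of the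
# closures `Z̄ = closure (β⁻¹(Z × T) ∖ E)`

Topic `Literature/AlgebraicGeometry/HodgeTheory`. THEOREMS ONLY (no definition, no named fact).

For a closed immersion `i : X ↪ Y` of smooth projective complex varieties (`dim X = n`,
`dim Y = n + r`, `r ≥ 1`) this file CONSTRUCTS the datum consumed by
`DeformationToNormalCone.map_mem_algebraicClasses_of_constantLift`
(`DeformationToNormalConeConstantLift`, hypothesis `hD`): `T = ℙ¹_ℂ` with `t₀ = (1:0)`, `t₁ = (0:1)`
(`ProjectiveSpace.pointOfVec`); the centre `X × {t₁} ↪ Y ⊗ T` (a closed immersion from a regular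
scheme, not all of `Y ⊗ T` since the slice at `t₀` misses it); `M` = a blowing up of `Y ⊗ T` along it,
smooth projective of dimension `n + r + 1` (`exists_isBlowup_ker_isSmoothProjective`); `φ = β ≫ pr_Y`;
the strict transform `J : X ⊗ T → M` = the lift of `i × 1_T` through the blowing up, which exists
because the centre pulls back to the effective Cartier divisor `X × {t₁} ⊂ X ⊗ T`
(`isEffectiveCartier_ker_sliceAt`); the exceptional divisor `E = M ×_{Y ⊗ T} X` with `k = pr₁`,
`q = pr₂` — a smooth projective variety of dimension `n + r`
(`Resolution.isSmoothProjective_exceptionalDivisor`) and a Zariski `ℙʳ`-bundle over `X`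
(`Resolution.isZariskiProjectiveBundle_exceptionalDivisor`, i.e. Hartshorne II 8.24 (b), the PROVED
fact `Hartshorne1977_exceptionalDivisor_locallyTrivial_holds`) — and the section `s = (ι_{t₁} ≫ J, 𝟙)`;
the slice at `t₀` misses `k(E)` (it lies over `t₀ ≠ t₁`); and `Z̄ Z = closure (φ⁻¹ Z ∖ k(E))` with
its codimension bookkeeping (`zbar_coheight_bookkeeping`):

* every point of `S = β⁻¹(pr_Y⁻¹ Z) ∖ k(E)` has codimension `≥ p` in `M` (off `k(E)` the blowing up
  is an isomorphism onto an open of `Y ⊗ T`, and codimension does not drop along the flat `pr_Y`,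
  Hartshorne III 9.5);
* hence so does every point of `closure S` (a specialisation of a point of `S`: the generic points
  of the components of the closure of the locally closed `S` lie in `S`,
  `exists_mem_inter_specializes_of_mem_closure`);
* and every point `e` of `E` with `k(e) ∈ closure S` has codimension `≥ p` in `E`: `k(e)` is a STRICT
  specialisation of a point of `S`, so has codimension `≥ p + 1` in `M`, and
  `codim_E e + 1 = codim_M k(e)` (dimension formula; closed immersions preserve heights).

* `exists_constantLiftDatum` — **the constant-lift deformation datum** (all inputs theorems).

Provenance: Literature home of
`Summits/HodgeConjecture/HodgeConjecture/Theorems/BoundaryReadoutPullbackAlgebraic{DeformationDatum,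
ZbarBookkeeping}.lean` (route `BoundaryReadout`, crux `PullbackAlgebraic`, stmt-HodgeConjecture-1071;
prover seats of that route), with the hypotheses `hα` (local triviality), `hE` (smooth projectivity of
the exceptional divisor) and `hZ` (bookkeeping) of the Summits datum discharged by the Literature
theorems named above, and the local-triviality clause stated on `Resolution.IsZariskiProjectiveBundle`.

## References

* [Fulton1998] W. Fulton, Intersection Theory, 2nd ed. (1998), §5.1, App. B.6.6, App. B.6.9.
* [Hartshorne1977] R. Hartshorne, Algebraic Geometry (1977), II Thm. 8.24, III Prop. 9.5, II Ex. 3.20.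
-/

noncomputable section

open CategoryTheory CategoryTheory.Limits AlgebraicGeometry MonoidalCategory CartesianMonoidalCategory
open Literature.AlgebraicGeometry Literature.AlgebraicGeometry.Motives Literature.AlgebraicGeometry.Resolution

namespace Literature.AlgebraicGeometry.HodgeTheory

namespace DeformationToNormalCone

/-! ### The parameter curve `ℙ¹` and its two points -/

/-- `(1 : 0) ≠ 0` in `ℂ²` (homogeneous coordinates of the point `t₀` of the parameter line of the
deformation, Fulton §5.1). [cite: Fulton1998, §5.1] -/
theorem vec10_ne_zero : (![1, 0] : Fin 2 → ℂ) ≠ 0 := by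
  intro h; have := congrFun h 0; simp at this

/-- `(0 : 1) ≠ 0` in `ℂ²` (homogeneous coordinates of the point `t₁ = ∞` of the parameter line).
[cite: Fulton1998, §5.1] -/
theorem vec01_ne_zero : (![0, 1] : Fin 2 → ℂ) ≠ 0 := by
  intro h; have := congrFun h 1; simp at this

/-- `(1 : 0) ≠ (0 : 1)` as points of `ℙ¹_ℂ` (`(0:1) ∈ D₊(x₁) ∌ (1:0)`): the two slices of the
deformation space are distinct. [cite: Fulton1998, §5.1] -/
theorem pt_pointOfVec10_ne_pt_pointOfVec01 :
    (ProjectiveSpace.pointOfVec ℂ (![1, 0] : Fin 2 → ℂ) vec10_ne_zero).pt ≠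
      (ProjectiveSpace.pointOfVec ℂ (![0, 1] : Fin 2 → ℂ) vec01_ne_zero).pt := by
  intro h
  have h1 := (ProjectiveSpace.pt_pointOfVec_mem_basicOpen_X_iff (k := ℂ)
    (![0, 1] : Fin 2 → ℂ) vec01_ne_zero 1).2 (by simp)
  have h0 : (ProjectiveSpace.pointOfVec ℂ (![1, 0] : Fin 2 → ℂ) vec10_ne_zero).pt ∉ _ := fun h' ↦
    (ProjectiveSpace.pt_pointOfVec_mem_basicOpen_X_iff (k := ℂ)
      (![1, 0] : Fin 2 → ℂ) vec10_ne_zero 1).1 h' (by simp)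
  exact h0 (h ▸ h1)

/-- The constant map `X → Spec ℂ →t T` takes the value `t.pt` everywhere. [cite: Fulton1998, §5.1] -/
theorem left_toSpecOver_comp_apply {X T : SchemeOver ℂ} (t : AlgPoints T ℂ) (x : X.left) :
    (toSpecOver X ≫ t).left x = t.pt := by
  haveI : Unique ↥(specOver ℂ ℂ).left := inferInstanceAs (Unique (PrimeSpectrum ℂ))
  change t.left (X.hom x) = t.left _
  congr 1
  exact Subsingleton.elim _ _

/-- `pr_T (ι_t ≫ (f × 1_T)) (x) = t`: the slice at `t` lies over `t`. [cite: Fulton1998, §5.1] -/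
theorem snd_sliceAt_whiskerRight_apply {X Y T : SchemeOver ℂ} (f : X ⟶ Y) (t : AlgPoints T ℂ)
    (x : X.left) : (snd Y T).left ((f ▷ T).left ((sliceAt X t).left x)) = t.pt := by
  rw [← Scheme.Hom.comp_apply, ← Scheme.Hom.comp_apply, ← Over.comp_left, ← Over.comp_left,
    whiskerRight_snd, sliceAt_snd]
  exact left_toSpecOver_comp_apply t x

/-! ### The codimension bookkeeping of the closures -/

/-- **Codimension bookkeeping of the closures in the deformation space.** For the blowing up
`β : B → Y ⊗ T` of `Y ⊗ T` along a closed immersion `ic : X ↪ Y ⊗ T` (an isomorphism over the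
complement of the centre; all schemes smooth projective, `dim Y = m + r`, `dim T = 1`, `dim B = m + r + 1`),
its exceptional divisor `pr₁ : E = B ×_{Y ⊗ T} X → B` (smooth projective of dimension `m + r`), and a
Zariski-closed `Z ⊆ Y` all of whose points have codimension `≥ p`: every point of the closure of
`S = β⁻¹(pr_Y⁻¹ Z) ∖ pr₁(E)` has codimension `≥ p` in `B`, and every point of `E` over that closure has
codimension `≥ p` in `E`. [cite: Fulton1998, §5.1 and App. B.6.6]
[cite: Hartshorne1977, III Prop. 9.5 and II Ex. 3.20] -/
theorem zbar_coheight_bookkeeping {m r : ℕ} {Y X B : SchemeOver ℂ} (T : SchemeOver ℂ) (ic : X ⟶ Y ⊗ T)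
    (β : B ⟶ Y ⊗ T) (hY : IsSmoothProjective (m + r) Y) (hT : IsSmoothProjective 1 T)
    (hic : IsClosedImmersion ic.left) (hB : IsSmoothProjective (m + r + 1) B)
    (hiso : IsIso (β.left ∣_ centreCompl ic.left.ker))
    (hE : IsSmoothProjective (m + r) (Over.mk (pullback.snd β.left ic.left ≫ X.hom) : SchemeOver ℂ))
    (p : ℕ) (Z : Set Y.left) (hZc : IsClosed Z) (hZp : ∀ z ∈ Z, (p : ℕ∞) ≤ Order.coheight z) :
    (∀ w ∈ closure ((β.left ≫ (fst Y T).left) ⁻¹' Z \ Set.range (pullback.fst β.left ic.left)),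
        (p : ℕ∞) ≤ Order.coheight w) ∧
      ∀ w ∈ (pullback.fst β.left ic.left) ⁻¹'
          closure ((β.left ≫ (fst Y T).left) ⁻¹' Z \ Set.range (pullback.fst β.left ic.left)),
        (p : ℕ∞) ≤ Order.coheight w := by
  haveI := hic
  haveI := hiso
  have hYT : IsSmoothProjective (m + r + 1) (Y ⊗ T) := IsSmoothProjective.tensor_holds hY hT
  haveI : IsLocallyNoetherian Y.left := IsSmoothProjective.isLocallyNoetherian_holds hY
  haveI : IsLocallyNoetherian (Y ⊗ T).left := IsSmoothProjective.isLocallyNoetherian_holds hYT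
  haveI : Flat (fst Y T).left := by
    change Flat (pullback.fst Y.hom T.hom)
    haveI : Subsingleton ↥(Spec (CommRingCat.of ℂ)) := inferInstanceAs (Subsingleton (PrimeSpectrum ℂ))
    exact MorphismProperty.pullback_fst _ _ inferInstance
  haveI : TopologicalSpace.NoetherianSpace ↥B.left := noetherianSpace_of_isSmoothProjective hB
  haveI : IsClosedImmersion (pullback.fst β.left ic.left) := inferInstance
  set U : (Y ⊗ T).left.Opens := centreCompl ic.left.ker with hU
  set S : Set B.left :=
    (β.left ≫ (fst Y T).left) ⁻¹' Z \ Set.range (pullback.fst β.left ic.left) with hS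
  -- (1) the points of `S` have codimension `≥ p`
  have hSp : ∀ w ∈ S, (p : ℕ∞) ≤ Order.coheight w := by
    rintro w ⟨hwZ, hwE⟩
    -- `β w` lies off the centre
    have hβw : β.left.base w ∈ U := by
      change β.left.base w ∈ ((centreCompl ic.left.ker : (Y ⊗ T).left.Opens) : Set (Y ⊗ T).left)
      rw [centreCompl_ker]
      intro hmem
      apply hwE
      rw [Scheme.Pullback.range_fst]
      exact hmem
    -- over `U` the blowing up is an isomorphism: codimension is preserved
    have hw : w ∈ β.left ⁻¹ᵁ U := hβw
    have hw' : w ∈ Set.range (β.left ⁻¹ᵁ U).ι.base := by rwa [Scheme.Opens.range_ι]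
    obtain ⟨w', rfl⟩ := hw'
    have e2 : β.left.base ((β.left ⁻¹ᵁ U).ι.base w') = U.ι.base ((β.left ∣_ U).base w') :=
      (congrArg (fun φ ↦ φ.base w') (morphismRestrict_ι β.left U)).symm
    have e3 := coheight_base_eq_of_iso (asIso (β.left ∣_ U)) w'
    rw [asIso_hom] at e3
    rw [coheight_eq_of_isOpenImmersion (β.left ⁻¹ᵁ U).ι, ← e3, ← coheight_eq_of_isOpenImmersion U.ι, ← e2]
    -- codimension does not drop along the flat `pr_Y`
    refine (hZp _ hwZ).trans ?_
    exact coheight_base_le_of_flat (fst Y T).left (β.left.base ((β.left ⁻¹ᵁ U).ι.base w'))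
  -- `S = F ∩ G` with `F` closed, `G` open
  have hF : IsClosed ((β.left ≫ (fst Y T).left) ⁻¹' Z) := hZc.preimage (β.left ≫ (fst Y T).left).continuous
  have hG : IsOpen (Set.range (pullback.fst β.left ic.left))ᶜ :=
    (pullback.fst β.left ic.left).isClosedEmbedding.isClosed_range.isOpen_compl
  have hSFG : S = (β.left ≫ (fst Y T).left) ⁻¹' Z ∩ (Set.range (pullback.fst β.left ic.left))ᶜ :=
    Set.sdiff_eq _ _
  refine ⟨fun w hw ↦ ?_, fun e he ↦ ?_⟩
  · -- (2) points of the closure are specialisations of points of `S`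
    rw [hSFG] at hw
    obtain ⟨ξ, hξ, hξw⟩ := exists_mem_inter_specializes_of_mem_closure hF hG hw
    rw [← hSFG] at hξ
    exact (hSp ξ hξ).trans (Order.coheight_anti (Scheme.le_iff_specializes.2 hξw))
  · -- (3) points of `E` over the closure: a strict specialisation, then the dimension formula
    have hw : (pullback.fst β.left ic.left).base e ∈ closure S := he
    rw [hSFG] at hw
    obtain ⟨ξ, hξ, hξw⟩ := exists_mem_inter_specializes_of_mem_closure hF hG hw
    have hne : ξ ≠ (pullback.fst β.left ic.left).base e := by
      rintro rfl
      exact hξ.2 (Set.mem_range_self e)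
    rw [← hSFG] at hξ
    have hk : ((p + 1 : ℕ) : ℕ∞) ≤ Order.coheight ((pullback.fst β.left ic.left).base e) := by
      have hlt : (pullback.fst β.left ic.left).base e < ξ := by
        refine lt_of_le_not_ge (Scheme.le_iff_specializes.2 hξw) fun h' ↦ hne ?_
        exact (hξw.antisymm (Scheme.le_iff_specializes.1 h')).eq
      calc ((p + 1 : ℕ) : ℕ∞) = (p : ℕ∞) + 1 := by push_cast; rfl
        _ ≤ Order.coheight ξ + 1 := add_le_add (hSp ξ hξ) le_rfl
        _ ≤ Order.coheight ((pullback.fst β.left ic.left).base e) := Order.coheight_add_one_le hlt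
    -- dimension formula on `B` and on `E`
    obtain ⟨a1, c1, ha1, hc1, h1⟩ := exists_height_eq_coheight_eq hB ((pullback.fst β.left ic.left).base e)
    obtain ⟨a2, c2, ha2, hc2, h2⟩ := exists_height_eq_coheight_eq hE e
    have hheq : Order.height ((pullback.fst β.left ic.left).base e) =
        @Order.height (↥(pullback β.left ic.left)) _ e :=
      Motives.Scheme.height_base_eq_of_isClosedImmersion (pullback.fst β.left ic.left) e
    have ha2' : @Order.height (↥(pullback β.left ic.left)) _ e = a2 := ha2
    have hc2' : @Order.coheight (↥(pullback β.left ic.left)) _ e = c2 := hc2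
    have e12 : a1 = a2 := by
      have h : (a1 : ℕ∞) = a2 := by rw [← ha1, ← ha2', hheq]
      exact_mod_cast h
    rw [hc1] at hk
    have hk' : p + 1 ≤ c1 := by exact_mod_cast hk
    change (p : ℕ∞) ≤ @Order.coheight (↥(pullback β.left ic.left)) _ e
    rw [hc2']
    have h : p ≤ c2 := by omega
    exact_mod_cast h

/-! ### The deformation space -/

/-- **The constant-lift deformation datum of a closed immersion of smooth projective complex
varieties** (deformation to the normal cone, Fulton 1998 §5.1; exceptional divisor by Hartshorne
II 8.24 (b)). For a closed immersion `i : X ↪ Y` (`dim X = n`, `dim Y = n + r`, `r ≥ 1`): a smooth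
projective curve `T` (`= ℙ¹`) with two complex points `t₀ ≠ t₁`, a smooth projective `M`
(`= Bl_{X × {t₁}}(Y ⊗ T)`) of dimension `n + r + 1` with `φ : M ⟶ Y` (blow-down, then `pr_Y`),
`J : X ⊗ T ⟶ M` (strict transform of `X × T`) with `ι_{t₀} ≫ J ≫ φ = i`, a smooth projective `E`
(exceptional divisor) of dimension `n + r` with `k : E ⟶ M` and a Zariski `ℙʳ`-bundle `q : E ⟶ X`, a
section `s` (`s ≫ q = 𝟙`, `s ≫ k = ι_{t₁} ≫ J`), the slice `ι_{t₀} ≫ J` missing `k(E)`, and for every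
Zariski-closed `Z ⊆ Y` the Zariski-closed `Z̄ = closure (φ⁻¹ Z ∖ k(E)) ⊆ M` with
`φ⁻¹ Z ⊆ Z̄ ∪ k(E)`, of codimension `≥ p` in `M` and with trace `k⁻¹ Z̄` of codimension `≥ p` in `E`
whenever `Z` has codimension `≥ p`. [cite: Fulton1998, §5.1 and App. B.6] [cite: Hartshorne1977, II Thm. 8.24] -/
theorem exists_constantLiftDatum {n r : ℕ} {X Y : SchemeOver ℂ} (i : X ⟶ Y) (hX : IsSmoothProjective n X)
    (hY : IsSmoothProjective (n + r) Y) (hi : IsClosedImmersion i.left) (_hr : 1 ≤ r) :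
    ∃ (T : SchemeOver ℂ) (t₀ t₁ : AlgPoints T ℂ) (M E : SchemeOver ℂ) (φ : M ⟶ Y)
      (J : X ⊗ T ⟶ M) (k : E ⟶ M) (q : E ⟶ X) (s : X ⟶ E) (Zbar : Set Y.left → Set M.left),
      IsSmoothProjective 1 T ∧ IsSmoothProjective (n + r + 1) M ∧ IsSmoothProjective (n + r) E ∧
      Motives.sliceAt X t₀ ≫ J ≫ φ = i ∧ s ≫ k = Motives.sliceAt X t₁ ≫ J ∧ s ≫ q = 𝟙 X ∧
      Disjoint (Set.range (Motives.sliceAt X t₀ ≫ J).left.base) (Set.range k.left.base) ∧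
      IsZariskiProjectiveBundle r q ∧
      ∀ (p : ℕ) (Z : Set Y.left), IsClosed Z → (∀ z ∈ Z, (p : ℕ∞) ≤ Order.coheight z) →
        IsClosed (Zbar Z) ∧ (∀ w ∈ Zbar Z, (p : ℕ∞) ≤ Order.coheight w) ∧
        φ.left.base ⁻¹' Z ⊆ Zbar Z ∪ Set.range k.left.base ∧
        ∀ w ∈ k.left.base ⁻¹' Zbar Z, (p : ℕ∞) ≤ Order.coheight w := by
  -- the curve and its two points
  let T : SchemeOver ℂ := projectiveSpace 1 ℂ
  have hT : IsSmoothProjective 1 T := isSmoothProjective_projectiveSpace' 1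
  haveI := hT.smoothOfRelativeDimension
  haveI : Smooth T.hom := SmoothOfRelativeDimension.smooth (n := 1) (f := T.hom)
  haveI : LocallyOfFiniteType T.hom := inferInstance
  let t₀ : AlgPoints T ℂ := ProjectiveSpace.pointOfVec ℂ (![1, 0] : Fin 2 → ℂ) vec10_ne_zero
  let t₁ : AlgPoints T ℂ := ProjectiveSpace.pointOfVec ℂ (![0, 1] : Fin 2 → ℂ) vec01_ne_zero
  -- the ambient space and the centre
  have hYT : IsSmoothProjective (n + r + 1) (Y ⊗ T) := IsSmoothProjective.tensor_holds hY hT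
  haveI : IsClosedImmersion i.left := hi
  let icO : X ⟶ Y ⊗ T := sliceAt X t₁ ≫ i ▷ T
  have hicO : icO = i ≫ sliceAt Y t₁ := sliceAt_whiskerRight i t₁
  haveI hic : IsClosedImmersion icO.left := by
    rw [hicO, Over.comp_left]
    haveI := isClosedImmersion_sliceAt_left (X := Y) t₁
    infer_instance
  -- the centre is not everything: the slice at `t₀` misses it
  haveI : Nonempty X.left := by
    haveI := IsSmoothProjective.isIntegral_holds hX
    infer_instance
  have hne : Set.range icO.left ≠ Set.univ := by
    intro h
    obtain ⟨x⟩ := ‹Nonempty X.left›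
    have hmem : (i ▷ T).left ((sliceAt X t₀).left x) ∈ Set.range icO.left := h ▸ Set.mem_univ _
    obtain ⟨x', hx'⟩ := hmem
    have h1 : (snd Y T).left (icO.left x') = t₁.pt := by
      change (snd Y T).left ((sliceAt X t₁ ≫ i ▷ T).left x') = t₁.pt
      rw [Over.comp_left, Scheme.Hom.comp_apply]
      exact snd_sliceAt_whiskerRight_apply i t₁ x'
    have h0 : (snd Y T).left ((i ▷ T).left ((sliceAt X t₀).left x)) = t₀.pt :=
      snd_sliceAt_whiskerRight_apply i t₀ x
    rw [hx'] at h1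
    exact pt_pointOfVec10_ne_pt_pointOfVec01 (h0.symm.trans h1)
  -- the blowing up
  obtain ⟨M, β, hβ, hM, -, hiso⟩ :=
    exists_isBlowup_ker_isSmoothProjective hYT icO.left (isRegular_of_isSmoothProjective' hX) hne
  -- the strict transform of `X ⊗ T`: the centre pulls back to the Cartier divisor `X × {t₁}`
  haveI hiT : IsClosedImmersion (i ▷ T).left :=
    AbelianVariety.whiskerRight_left_mem (W := @IsClosedImmersion) i hi
  have hcart : IsEffectiveCartier (icO.left.ker.comap (i ▷ T).left) := by
    have e1 : icO.left = (sliceAt X t₁).left ≫ (i ▷ T).left := rfl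
    rw [← Scheme.IdealSheafData.ker_fst_of_isClosedImmersion]
    have hfst : pullback.fst (i ▷ T).left icO.left =
        pullback.snd (i ▷ T).left icO.left ≫ (sliceAt X t₁).left := by
      rw [← cancel_mono (i ▷ T).left, Category.assoc, ← e1]
      exact pullback.condition
    haveI : IsIso (pullback.snd (i ▷ T).left icO.left) := by
      rw [e1]; infer_instance
    rw [hfst, Scheme.Hom.ker_comp_of_isIso]
    exact isEffectiveCartier_ker_sliceAt (X := X) hT t₁
  let J : X ⊗ T ⟶ M := Over.homMk (hβ.lift (i ▷ T).left hcart) (by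
    rw [← Over.w β, ← Category.assoc, hβ.lift_comp, Over.w])
  have hJβ : J ≫ β = i ▷ T := by
    refine Over.OverMorphism.ext ?_
    rw [Over.comp_left]
    exact hβ.lift_comp (i ▷ T).left hcart
  -- the exceptional divisor: smooth projective of dimension `n + r`, a Zariski `ℙʳ`-bundle over `X`
  let E : SchemeOver ℂ := Over.mk (pullback.snd β.left icO.left ≫ X.hom)
  let k : E ⟶ M := Over.homMk (pullback.fst β.left icO.left) (by
    change pullback.fst β.left icO.left ≫ M.hom = pullback.snd β.left icO.left ≫ X.hom
    rw [← Over.w β, pullback.condition_assoc, Over.w icO])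
  let q : E ⟶ X := Over.homMk (pullback.snd β.left icO.left) rfl
  have hEsp : IsSmoothProjective (n + r) E :=
    Resolution.isSmoothProjective_exceptionalDivisor icO β hYT hX hic hβ
  have htriv : IsZariskiProjectiveBundle r q :=
    Resolution.isZariskiProjectiveBundle_exceptionalDivisor (k := ℂ) (r := r) icO β hYT hX hic hβ
  -- the section
  have hsJ : ((sliceAt X t₁).left ≫ J.left) ≫ β.left = 𝟙 X.left ≫ icO.left := by
    rw [Category.id_comp, Category.assoc, ← Over.comp_left, hJβ, ← Over.comp_left]
  let s : X ⟶ E := Over.homMk (pullback.lift ((sliceAt X t₁).left ≫ J.left) (𝟙 X.left) hsJ) (by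
    change pullback.lift _ _ hsJ ≫ pullback.snd β.left icO.left ≫ X.hom = X.hom
    rw [pullback.lift_snd_assoc, Category.id_comp])
  have hsk : s ≫ k = sliceAt X t₁ ≫ J := by
    refine Over.OverMorphism.ext ?_
    rw [Over.comp_left, Over.comp_left]
    exact pullback.lift_fst _ _ _
  have hsq : s ≫ q = 𝟙 X := by
    refine Over.OverMorphism.ext ?_
    rw [Over.comp_left]
    exact pullback.lift_snd _ _ _
  -- the closures
  let Zbar : Set Y.left → Set M.left := fun Z ↦
    closure ((β.left ≫ (fst Y T).left) ⁻¹' Z \ Set.range (pullback.fst β.left icO.left))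
  refine ⟨T, t₀, t₁, M, E, β ≫ fst Y T, J, k, q, s, Zbar, hT, hM, hEsp, ?_, hsk, hsq, ?_, htriv, ?_⟩
  · -- `ι_{t₀} ≫ J ≫ φ = i`
    rw [← Category.assoc J β (fst Y T), hJβ, whiskerRight_fst, ← Category.assoc, sliceAt_fst,
      Category.id_comp]
  · -- the slice at `t₀` misses `k(E)`: they lie over `t₀ ≠ t₁`
    refine Set.disjoint_left.2 ?_
    rintro _ ⟨x, rfl⟩ ⟨e, he⟩
    apply pt_pointOfVec10_ne_pt_pointOfVec01
    have h0 : (snd Y T).left (β.left ((sliceAt X t₀ ≫ J).left x)) = t₀.pt := by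
      have e1 : (sliceAt X t₀ ≫ J).left x = J.left ((sliceAt X t₀).left x) := by
        rw [Over.comp_left]; rfl
      rw [e1, ← Scheme.Hom.comp_apply J.left β.left, ← Over.comp_left, hJβ]
      exact snd_sliceAt_whiskerRight_apply i t₀ x
    have hc : ∀ e' : ↥(pullback β.left icO.left),
        β.left (pullback.fst β.left icO.left e') = icO.left (pullback.snd β.left icO.left e') :=
      fun e' ↦ by rw [← Scheme.Hom.comp_apply, pullback.condition, Scheme.Hom.comp_apply]
    have h1 : (snd Y T).left (β.left (k.left e)) = t₁.pt := by
      change (snd Y T).left (β.left (pullback.fst β.left icO.left e)) = t₁.pt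
      rw [hc e]
      exact snd_sliceAt_whiskerRight_apply i t₁ _
    change k.left e = (sliceAt X t₀ ≫ J).left x at he
    rw [← he] at h0
    exact h0.symm.trans h1
  · -- the closures: closed, `φ⁻¹ Z ⊆ Z̄ ∪ k(E)`, and the codimension bookkeeping
    intro p Z hZc hZp
    obtain ⟨h1, h2⟩ := zbar_coheight_bookkeeping T icO β hY hT hic hM hiso hEsp p Z hZc hZp
    refine ⟨isClosed_closure, h1, fun w hw ↦ ?_, h2⟩
    by_cases hwE : w ∈ Set.range (pullback.fst β.left icO.left)
    · exact Or.inr hwE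
    · exact Or.inl (subset_closure ⟨hw, hwE⟩)

end DeformationToNormalCone

end Literature.AlgebraicGeometry.HodgeTheory

end
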